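import Mathlib
import Summits.CriticalPhenomena.CardyFormulaZ2.Theorems.CardyMagicRigidityNestingRigidityBigLoopsExpMoment
import Summits.CriticalPhenomena.CardyFormulaZ2.Theorems.CardyMagicRigidityNestingRigidityTowerCountMeasurable
import Summits.CriticalPhenomena.CardyFormulaZ2.Theorems.CardyMagicRigidityMagicFormulaTStubDilation
import Literature.Probability.Percolation.LoopRotationInvarianceProofs
import Literature.Probability.Percolation.IsoradialRectangularLoops
import HarnessLib

/-!
# Crux `NestingRigidity`, line `positive-cone-weight-doubling`: exact DILATION COVARIANCE of the
# two lattice loop ensembles, and keystone K6 at ALL SCALES (scale-uniform constants)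

Crux `Summit.CriticalPhenomena.CardyFormulaZ2.Theses.CardyMagicRigidity.NestingRigidity`
(stmt-CriticalPhenomena-4835), line `positive-cone-weight-doubling`, registered helper [A]
`uvExpMoments_latticeEnsembles`.  The multi-scale proof of [A] uses the all-order exponential
moments of big-loop counts (keystone K6 `expMoment_ncard_bigLoops_le`, landed) at EVERY dyadic
scale `λ = 2^{-k} r` with ONE constant.  K6 as registered fixes the window `(R, η)`; scale
uniformity is the exact dilation covariance of the lattice models: the loops of `X_{cδ}(ω)` are the
`c`-dilates of the loops of `X_δ(ω)` for the SAME configuration `ω` (no cited fact, no definition):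

* §1 bond-`ℤ²`: `loopCurve (cδ) 0 γ` is the image of `loopCurve δ 0 γ` under `z ↦ cz`
  (`apply_polyline`: a linear map commutes with the dyadic polyline; `medialPoint_mul`), whence
  `(zEns.X (cδ) ω).loops = (z ↦ cz) '' (zEns.X δ ω).loops` as unbased loops
  (`UnbasedLoop.imageOn`); §2 the same on site-`𝕋` (`hexLoopCurve`, two-mesh version of
  `hexLoopCurve_eq_map`); both: `loops_mul_latticeEnsembles`;
* §3 the big-loop count is dilation invariant: `#{u ∈ X_{cδ} | trace ⊆ B(0, cR), diam ≥ cη} =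
  #{u ∈ X_δ | trace ⊆ B(0, R), diam ≥ η}` pathwise (`c > 0`; injectivity of the dilation,
  `range_imageOn`, `diam_smul₀`);
* §4 **K6 at all scales** (registered anchor `expMoment_ncard_bigLoops_le_scale`): for
  `E ∈ latticeEnsembles` and all `s R η` (`0 < η ≤ R`) there are `C, c₀ > 0` with
  `E_δ[exp(s · #{u ∈ X_δ | trace ⊆ B(0, λR), diam ≥ λη})] ≤ C` for ALL `λ > 0` and all meshes
  `0 < δ`, `c₀ δ ≤ λη` (apply K6 at mesh `δ/λ`).
-/

noncomputable section

open MeasureTheory Set Filter Metric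
open scoped Real Topology BigOperators Pointwise

namespace Summit.CriticalPhenomena.CardyFormulaZ2.Cruxes.NestingRigidity.PositiveConeWeightDoubling

open Literature.Probability.RandomPlanarGeometry Literature.Probability.Percolation
  Literature.Probability.LatticeModels
open Summit.CriticalPhenomena.CardyFormulaZ2.Cruxes.NestingRigidity.RingCloudTomography
open Summit.CriticalPhenomena.CardyFormulaZ2.Cruxes.MagicFormulaT.LineSketch
  (basedLoop_mk_congr curve_imageOn_mul_eq_map imageOn_mul_injective)

namespace UVExpMoments

/-! ## §1 Bond-`ℤ²`: the drawn loop at mesh `cδ` is the `c`-dilate of the drawn loop at mesh `δ` -/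

/-- The dilation `z ↦ cz` of `ℂ` is affine on segments. -/
theorem mul_lineMap (c : ℂ) (x y : ℂ) (a : ℝ) :
    c * AffineMap.lineMap x y a = AffineMap.lineMap (c * x) (c * y) a := by
  simp only [AffineMap.lineMap_apply_module', Complex.real_smul]; ring

/-- **Bond-`ℤ²`, curves**: `loopCurve (cδ) 0 γ` is the image of `loopCurve δ 0 γ` under `z ↦ cz`. -/
theorem loopCurve_mul (c δ : ℝ) (γ : List MedialVertex) :
    loopCurve (c * δ) 0 γ = (loopCurve δ 0 γ).imageOn (fun z ↦ (c : ℂ) * z) univ := by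
  rw [loopCurve_eq_mk_polyline, loopCurve_eq_mk_polyline, CurveClass.imageOn_mk,
    curve_imageOn_mul_eq_map]
  congr 1
  apply Curve.ext
  ext u
  change polyline (List.map (fun e ↦ Complex.exp ((0 : ℝ) * Complex.I) * medialPoint (c * δ) e)
      (γ ++ γ.take 1)) u =
    (c : ℂ) * polyline (List.map (fun e ↦ Complex.exp ((0 : ℝ) * Complex.I) * medialPoint δ e)
      (γ ++ γ.take 1)) u + 0
  rw [add_zero, apply_polyline (fun z : ℂ ↦ (c : ℂ) * z) (mul_zero _) (fun x y a ↦ mul_lineMap _ x y a),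
    List.map_map]
  congr 2
  exact List.map_congr_left fun e _ ↦ by simp only [Function.comp_apply, medialPoint_mul]; ring

/-- **Bond-`ℤ²`, unbased loops**: the dilation by `c` maps the drawn loop at mesh `δ` to the drawn
loop at mesh `cδ`. -/
theorem imageOn_mul_bondLoop (c δ : ℝ) {γ : List MedialVertex} (hγ : γ ≠ []) :
    UnbasedLoop.imageOn (fun z ↦ (c : ℂ) * z) univ
        (UnbasedLoop.mk (BasedLoop.mk (loopCurve δ 0 γ) (isLoop_loopCurve δ 0 hγ))) =
      UnbasedLoop.mk (BasedLoop.mk (loopCurve (c * δ) 0 γ) (isLoop_loopCurve (c * δ) 0 hγ)) := by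
  rw [UnbasedLoop.imageOn_mk]
  refine congrArg UnbasedLoop.mk ?_
  change BasedLoop.mk ((BasedLoop.mk (loopCurve δ 0 γ) (isLoop_loopCurve δ 0 hγ)).toCurveClass.imageOn
    (fun z ↦ (c : ℂ) * z) univ) _ = _
  apply basedLoop_mk_congr
  rw [BasedLoop.toCurveClass_mk, loopCurve_mul]

/-- **Dilation covariance of the bond-`ℤ²` loop ensemble**: for every configuration `ω` and all
real `c, δ`, the loops of `X_{cδ}(ω)` are the `c`-dilates of the loops of `X_δ(ω)`. -/
theorem loops_zEns_mul (c δ : ℝ) (ω : BondConfig (Site 2)) :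
    (zEns.X (c * δ) ω).loops = UnbasedLoop.imageOn (fun z ↦ (c : ℂ) * z) univ '' (zEns.X δ ω).loops := by
  rw [loops_zEns_eq_image, loops_zEns_eq_image, Set.image_image]
  exact Set.image_congr fun k _ ↦ (imageOn_mul_bondLoop c δ k.2).symm

/-! ## §2 Site-`𝕋`: the same -/

/-- **Site-`𝕋`, curves**: `hexLoopCurve (cδ) w` is the image of `hexLoopCurve δ w` under `z ↦ cz`
(two-mesh version of `hexLoopCurve_eq_map`). -/
theorem hexLoopCurve_mul {f₀ g₀ : HexVertex} (c δ : ℝ) (w : hexGraph.Walk f₀ g₀) :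
    hexLoopCurve (c * δ) w = (hexLoopCurve δ w).map ⟨fun z ↦ (c : ℂ) * z + 0, by fun_prop⟩ := by
  apply Curve.ext
  ext u
  change (w.toCurve fun v ↦ ((c * δ : ℝ) : ℂ) * hexCenter v) u =
    (c : ℂ) * (w.toCurve fun v ↦ (δ : ℂ) * hexCenter v) u + 0
  simp only [SimpleGraph.Walk.toCurve, add_zero]
  have hl : w.support.map ((fun z : ℂ ↦ (c : ℂ) * z) ∘ fun v ↦ (δ : ℂ) * hexCenter v) =
      w.support.map fun v ↦ ((c * δ : ℝ) : ℂ) * hexCenter v :=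
    List.map_congr_left fun v _ ↦ by simp only [Function.comp_apply, Complex.ofReal_mul]; ring
  rw [apply_polyline (fun z : ℂ ↦ (c : ℂ) * z) (mul_zero _) (fun x y a ↦ mul_lineMap _ x y a),
    List.map_map, hl]

/-- **Site-`𝕋`, unbased loops**: the dilation by `c` maps the drawn loop at mesh `δ` to the drawn
loop at mesh `cδ`. -/
theorem imageOn_mul_siteLoop_mul (c δ : ℝ) {v : HexVertex} (γ : hexGraph.Walk v v) :
    UnbasedLoop.imageOn (fun z ↦ (c : ℂ) * z) univ
        (UnbasedLoop.mk (BasedLoop.mk (siteLoopCurve δ γ) (isLoop_siteLoopCurve δ γ))) =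
      UnbasedLoop.mk (BasedLoop.mk (siteLoopCurve (c * δ) γ) (isLoop_siteLoopCurve (c * δ) γ)) := by
  rw [UnbasedLoop.imageOn_mk]
  refine congrArg UnbasedLoop.mk ?_
  change BasedLoop.mk ((BasedLoop.mk (siteLoopCurve δ γ) (isLoop_siteLoopCurve δ γ)).toCurveClass.imageOn
    (fun z ↦ (c : ℂ) * z) univ) _ = _
  apply basedLoop_mk_congr
  rw [BasedLoop.toCurveClass_mk]
  change (CurveClass.mk (hexLoopCurve δ γ)).imageOn (fun z ↦ (c : ℂ) * z) univ =
    CurveClass.mk (hexLoopCurve (c * δ) γ)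
  rw [CurveClass.imageOn_mk, curve_imageOn_mul_eq_map, ← hexLoopCurve_mul]

/-- **Dilation covariance of the site-`𝕋` loop ensemble**. -/
theorem loops_tEns_mul (c δ : ℝ) (ω : SiteConfig (Site 2)) :
    (tEns.X (c * δ) ω).loops = UnbasedLoop.imageOn (fun z ↦ (c : ℂ) * z) univ '' (tEns.X δ ω).loops := by
  rw [loops_tEns_eq_image, loops_tEns_eq_image, Set.image_image]
  exact Set.image_congr fun k _ ↦ (imageOn_mul_siteLoop_mul c δ k.2).symm

/-! ## §3 The big-loop count is dilation invariant -/

/-- The trace of a dilated loop is the dilated trace. -/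
theorem range_imageOn_mul (c : ℝ) (u : UnbasedLoop ℂ) :
    (UnbasedLoop.imageOn (fun z ↦ (c : ℂ) * z) univ u).range = (c : ℂ) • u.range := by
  rw [UnbasedLoop.range_imageOn (by fun_prop) (subset_univ _), ← Set.image_smul]
  rfl

/-- **Pathwise dilation invariance of the big-loop count** (`c > 0`): among the `c`-dilates of a loop
family, the loops inside `B(0, cR)` of diameter `≥ cη` correspond bijectively to the loops of the
family inside `B(0, R)` of diameter `≥ η`. -/
theorem ncard_bigLoops_image_mul {c : ℝ} (hc : 0 < c) (L : Set (UnbasedLoop ℂ)) (R η : ℝ) :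
    {u ∈ UnbasedLoop.imageOn (fun z ↦ (c : ℂ) * z) univ '' L |
        u.range ⊆ ball (0 : ℂ) (c * R) ∧ c * η ≤ diam u.range}.ncard =
      {u ∈ L | u.range ⊆ ball (0 : ℂ) R ∧ η ≤ diam u.range}.ncard := by
  have hc0 : (c : ℂ) ≠ 0 := Complex.ofReal_ne_zero.2 hc.ne'
  have hnorm : ‖(c : ℂ)‖ = c := by rw [Complex.norm_real, Real.norm_of_nonneg hc.le]
  have hball : ball (0 : ℂ) (c * R) = (c : ℂ) • ball (0 : ℂ) R := by
    rw [_root_.smul_ball hc0, smul_zero, hnorm]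
  have hiff : ∀ u : UnbasedLoop ℂ,
      ((UnbasedLoop.imageOn (fun z ↦ (c : ℂ) * z) univ u).range ⊆ ball (0 : ℂ) (c * R) ∧
        c * η ≤ diam (UnbasedLoop.imageOn (fun z ↦ (c : ℂ) * z) univ u).range) ↔
      (u.range ⊆ ball (0 : ℂ) R ∧ η ≤ diam u.range) := fun u ↦ by
    rw [range_imageOn_mul, hball, Set.smul_set_subset_smul_set_iff₀ hc0, diam_smul₀, hnorm,
      mul_le_mul_iff_of_pos_left hc]
  have hset : {u ∈ UnbasedLoop.imageOn (fun z ↦ (c : ℂ) * z) univ '' L |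
      u.range ⊆ ball (0 : ℂ) (c * R) ∧ c * η ≤ diam u.range} =
      UnbasedLoop.imageOn (fun z ↦ (c : ℂ) * z) univ '' {u ∈ L | u.range ⊆ ball (0 : ℂ) R ∧ η ≤ diam u.range} := by
    ext v
    simp only [mem_setOf_eq, mem_image]
    constructor
    · rintro ⟨⟨u, hu, rfl⟩, hv⟩
      exact ⟨u, ⟨hu, (hiff u).1 hv⟩, rfl⟩
    · rintro ⟨u, ⟨hu, hq⟩, rfl⟩
      exact ⟨⟨u, hu, rfl⟩, (hiff u).2 hq⟩
  rw [hset, Set.ncard_image_of_injective _ (imageOn_mul_injective hc.ne')]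

end UVExpMoments

/-- **Dilation covariance of both lattice loop ensembles** (registered helper, line
`positive-cone-weight-doubling`): for `E ∈ latticeEnsembles`, every configuration `ω` and all real
`c, δ`, the loops of `X_{cδ}(ω)` are exactly the `c`-dilates `z ↦ cz` of the loops of `X_δ(ω)`. -/
theorem loops_mul_latticeEnsembles : ∀ E ∈ latticeEnsembles, ∀ (c δ : ℝ) (ω : E.Ω),
    (E.X (c * δ) ω).loops = UnbasedLoop.imageOn (fun z ↦ (c : ℂ) * z) Set.univ '' (E.X δ ω).loops := by
  intro E hE c δ ω
  simp only [latticeEnsembles, Set.mem_insert_iff, Set.mem_singleton_iff] at hE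
  rcases hE with rfl | rfl
  · exact UVExpMoments.loops_zEns_mul c δ ω
  · exact UVExpMoments.loops_tEns_mul c δ ω

/-- **Keystone K6 at ALL SCALES, both lattice ensembles** (registered helper toward [A]
`uvExpMoments_latticeEnsembles`, line `positive-cone-weight-doubling`): for `E ∈ latticeEnsembles`
and all `s R η` (`0 < η ≤ R`) there are `C, c₀ > 0` such that for EVERY scale `λ > 0` and every mesh
`0 < δ` with `c₀ δ ≤ λ η`, the number of loops of `X_δ` with trace in `B(0, λR)` and diameter `≥ λη`
has `E_δ[exp(s · #)] ≤ C` — ONE constant for all dyadic scales (K6 `expMoment_ncard_bigLoops_le` at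
mesh `δ/λ`, transported by the exact dilation covariance `loops_mul_latticeEnsembles`). -/
theorem expMoment_ncard_bigLoops_le_scale : ∀ E ∈ latticeEnsembles, ∀ (s R η : ℝ), 0 < η → η ≤ R →
    ∃ C c₀ : ℝ, 0 < C ∧ 0 < c₀ ∧ ∀ (l δ : ℝ), 0 < l → 0 < δ → c₀ * δ ≤ l * η →
      Integrable (fun ω ↦ Real.exp (s * ({u ∈ (E.X δ ω).loops |
        u.range ⊆ Metric.ball (0 : ℂ) (l * R) ∧ l * η ≤ Metric.diam u.range}.ncard : ℝ))) E.P ∧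
      ∫ ω, Real.exp (s * ({u ∈ (E.X δ ω).loops |
        u.range ⊆ Metric.ball (0 : ℂ) (l * R) ∧ l * η ≤ Metric.diam u.range}.ncard : ℝ)) ∂E.P ≤ C := by
  intro E hE s R η hη hηR
  obtain ⟨C, c₀, hC, hc₀, h⟩ := expMoment_ncard_bigLoops_le E hE s R η hη hηR
  refine ⟨C, c₀, hC, hc₀, fun l δ hl hδ hcδ ↦ ?_⟩
  have key : ∀ ω, ({u ∈ (E.X δ ω).loops |
      u.range ⊆ Metric.ball (0 : ℂ) (l * R) ∧ l * η ≤ Metric.diam u.range}.ncard : ℝ) =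
      ({u ∈ (E.X (δ / l) ω).loops |
        u.range ⊆ Metric.ball (0 : ℂ) R ∧ η ≤ Metric.diam u.range}.ncard : ℝ) := fun ω ↦ by
    have hX : E.X δ ω = E.X (l * (δ / l)) ω := by rw [mul_div_cancel₀ _ hl.ne']
    rw [hX, loops_mul_latticeEnsembles E hE l (δ / l) ω, UVExpMoments.ncard_bigLoops_image_mul hl]
  simp_rw [key]
  exact h (δ / l) (div_pos hδ hl) (by rw [← mul_div_assoc, div_le_iff₀ hl]; linarith)

end Summit.CriticalPhenomena.CardyFormulaZ2.Cruxes.NestingRigidity.PositiveConeWeightDoubling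

end
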